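import Summits.SmoothPoincare4.SmoothPoincare4.Theorems.CongruenceShadowsNormalFormStablyTrivialLuftStubMovesGoeritzAux
import Mathlib.Tactic.Group

/-!
# Stub `stub_movesGoeritz` of line `luft-twist-reduction` for crux `NormalFormStablyTrivial`
# (item stmt-SmoothPoincare4-14591, route `CongruenceShadows`) — auxiliary file 2: the drag of
# the knob `k` around the handle `l` (Goeritz realisation of a partial conjugation)

In the `a`-normalisation of `…LuftStubMovesGoeritzAux.lean` (cut system `{aᵢ}` with erasure
`eraseA : aᵢ ↦ 1, bᵢ ↦ xᵢ`, and a second cut system `cutKernel d`, `d i = true` on the TRIVIAL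
handles) this file realises the PARTIAL CONJUGATION `x_t ↦ x_j⁻¹ x_t x_j` of a trivial letter
`x_t` (`d t = true`) by the letter `x_j` of another handle of either type, for `t = k`,
`j = l`, `k < l`, by an explicit automorphism of `S_g` moving only the handles `k`, `l`,
stabilising `cutKernel d` (and `⟪aᵢ⟫`, as every inducing automorphism does) and inducing the move
ON THE NOSE through `eraseA`:

* `exists_dragLt` — the DRAG of the knob `k` around the handle `l`: the automorphism with the
  displayed two-handle generator images (`A,B,C,D = a_k,b_k,a_l,b_l`, `m = mid k l`; relator
  fixed on the nose, inverse images displayed), found as the composite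
  `flip_k⁻¹ ∘ slide_{kl} ∘ flip_k⁻¹ ∘ slide_{kl}` of the moves of
  `SurfaceGroupHandleMoves.lean` (which induces `α_k β_{kl} α_k β_{kl} = (x_k ↦ x_l⁻¹ x_k x_l)` on
  `F_g = S_g ⧸ ⟪aᵢ⟫`), written out so that all checks are identities between short words;
* `helper_movesGoeritz_2` (registered helper) — for every cut pattern `d` with `d k = true` the drag
  stabilises `cutKernel d` (two-handle erasure test `map_cutKernel_eq_of_block`) and induces
  `partialConj k l : x_k ↦ x_l⁻¹ x_k x_l` (`eraseA_apply_eq_of_block`).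

Geometrically this is the annulus twist dragging the stabilising genus-one summand `t` of the
Heegaard splitting once around the core of handle `j`; only the algebra is formalised (all
identities are identities of free groups, discharged by `group`).
-/

-- the prescribed namespace `Summit.<P>.<Sub>.…` duplicates `SmoothPoincare4` (P = Sub)
set_option linter.dupNamespace false

noncomputable section

namespace Summit.SmoothPoincare4.SmoothPoincare4.Theorems.NormalFormStablyTrivial.Luft

open Literature.Topology.FourManifolds Literature.Topology.FourManifolds.SurfaceGroup
open Literature.GroupTheory.CombinatorialGroupTheory Subgroup

/-! ## §1 The drag of the knob `k` around the handle `l` (`k < l`) -/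

set_option maxHeartbeats 1600000 in
/-- **The drag of handle `k` around handle `l`** (`k < l`): an automorphism of `S_g` moving only the
handles `k`, `l`, with the displayed generator images and inverse generator images (the composite
`flip_k⁻¹ ∘ slide ∘ flip_k⁻¹ ∘ slide`; with `c = [a_k,b_k]`, `m = mid k l`, `D = b_l`: `a_k ↦ c
(mD⁻¹m⁻¹) a_k (mDm⁻¹) c⁻¹`, `b_k ↦ c (mD⁻¹m⁻¹) b_k (mDm⁻¹) c⁻¹`, `a_l ↦ (m⁻¹cm) D⁻¹ (m⁻¹c⁻¹m) D a_l
(m⁻¹c⁻¹m)`, `b_l ↦ (m⁻¹cm) D (m⁻¹c⁻¹m)`). [folklore] -/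
theorem exists_dragLt {g : ℕ} {k l : Fin g} (hkl : k < l) :
    ∃ y : SurfaceGroup g ≃* SurfaceGroup g,
      (∀ p, y (PresentedGroup.of p) = blockGens k l
        (a k * b k * (a k)⁻¹ * (b k)⁻¹ * mid k l * (b l)⁻¹ * (mid k l)⁻¹ * a k * mid k l * b l *
          (mid k l)⁻¹ * b k * a k * (b k)⁻¹ * (a k)⁻¹)
        (a k * b k * (a k)⁻¹ * (b k)⁻¹ * mid k l * (b l)⁻¹ * (mid k l)⁻¹ * b k * mid k l * b l *
          (mid k l)⁻¹ * b k * a k * (b k)⁻¹ * (a k)⁻¹)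
        ((mid k l)⁻¹ * a k * b k * (a k)⁻¹ * (b k)⁻¹ * mid k l * (b l)⁻¹ * (mid k l)⁻¹ * b k *
          a k * (b k)⁻¹ * (a k)⁻¹ * mid k l * b l * a l * (mid k l)⁻¹ * b k * a k * (b k)⁻¹ *
          (a k)⁻¹ * mid k l)
        ((mid k l)⁻¹ * a k * b k * (a k)⁻¹ * (b k)⁻¹ * mid k l * b l * (mid k l)⁻¹ * b k * a k *
          (b k)⁻¹ * (a k)⁻¹ * mid k l) p) ∧
      (∀ p, y.symm (PresentedGroup.of p) = blockGens k l
        (mid k l * b l * (mid k l)⁻¹ * b k * a k * (b k)⁻¹ * a k * b k * (a k)⁻¹ * (b k)⁻¹ *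
          mid k l * (b l)⁻¹ * (mid k l)⁻¹)
        (mid k l * b l * (mid k l)⁻¹ * b k * a k * (b k)⁻¹ * (a k)⁻¹ * b k * a k * b k * (a k)⁻¹ *
          (b k)⁻¹ * mid k l * (b l)⁻¹ * (mid k l)⁻¹)
        (b l * (mid k l)⁻¹ * b k * a k * (b k)⁻¹ * (a k)⁻¹ * mid k l * (b l)⁻¹ * (mid k l)⁻¹ *
          a k * b k * (a k)⁻¹ * (b k)⁻¹ * mid k l * a l * b l * (mid k l)⁻¹ * a k * b k *
          (a k)⁻¹ * (b k)⁻¹ * mid k l * (b l)⁻¹)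
        (b l * (mid k l)⁻¹ * b k * a k * (b k)⁻¹ * (a k)⁻¹ * mid k l * b l * (mid k l)⁻¹ * a k *
          b k * (a k)⁻¹ * (b k)⁻¹ * mid k l * (b l)⁻¹) p) := by
  refine ⟨equivOfGens
      (blockGens k l
        (a k * b k * (a k)⁻¹ * (b k)⁻¹ * mid k l * (b l)⁻¹ * (mid k l)⁻¹ * a k * mid k l * b l *
          (mid k l)⁻¹ * b k * a k * (b k)⁻¹ * (a k)⁻¹)
        (a k * b k * (a k)⁻¹ * (b k)⁻¹ * mid k l * (b l)⁻¹ * (mid k l)⁻¹ * b k * mid k l * b l *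
          (mid k l)⁻¹ * b k * a k * (b k)⁻¹ * (a k)⁻¹)
        ((mid k l)⁻¹ * a k * b k * (a k)⁻¹ * (b k)⁻¹ * mid k l * (b l)⁻¹ * (mid k l)⁻¹ * b k *
          a k * (b k)⁻¹ * (a k)⁻¹ * mid k l * b l * a l * (mid k l)⁻¹ * b k * a k * (b k)⁻¹ *
          (a k)⁻¹ * mid k l)
        ((mid k l)⁻¹ * a k * b k * (a k)⁻¹ * (b k)⁻¹ * mid k l * b l * (mid k l)⁻¹ * b k * a k *
          (b k)⁻¹ * (a k)⁻¹ * mid k l))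
      (blockGens k l
        (mid k l * b l * (mid k l)⁻¹ * b k * a k * (b k)⁻¹ * a k * b k * (a k)⁻¹ * (b k)⁻¹ *
          mid k l * (b l)⁻¹ * (mid k l)⁻¹)
        (mid k l * b l * (mid k l)⁻¹ * b k * a k * (b k)⁻¹ * (a k)⁻¹ * b k * a k * b k * (a k)⁻¹ *
          (b k)⁻¹ * mid k l * (b l)⁻¹ * (mid k l)⁻¹)
        (b l * (mid k l)⁻¹ * b k * a k * (b k)⁻¹ * (a k)⁻¹ * mid k l * (b l)⁻¹ * (mid k l)⁻¹ *
          a k * b k * (a k)⁻¹ * (b k)⁻¹ * mid k l * a l * b l * (mid k l)⁻¹ * a k * b k *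
          (a k)⁻¹ * (b k)⁻¹ * mid k l * (b l)⁻¹)
        (b l * (mid k l)⁻¹ * b k * a k * (b k)⁻¹ * (a k)⁻¹ * mid k l * b l * (mid k l)⁻¹ * a k *
          b k * (a k)⁻¹ * (b k)⁻¹ * mid k l * (b l)⁻¹))
      (prod_relFactor_blockGens hkl _ _ _ _ (by group))
      (prod_relFactor_blockGens hkl _ _ _ _ (by group)) ?_ ?_,
    fun p => equivOfGens_of _ _ _ _ _ _ p, fun p => equivOfGens_symm_of _ _ _ _ _ _ p⟩
  · -- `y⁻¹ ∘ y = id` on the generators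
    rintro ⟨i, s⟩
    by_cases hik : i = k
    · subst hik
      cases s
      · rw [← a_def]
        simp only [blockGens_k_false, map_mul, map_inv, homOfGens_a, homOfGens_b,
            blockGens_k_true, blockGens_l_true hkl, homOfGens_blockGens_mid]
        group
      · rw [← b_def]
        simp only [blockGens_k_true, map_mul, map_inv, homOfGens_a, homOfGens_b,
            blockGens_k_false, blockGens_l_true hkl, homOfGens_blockGens_mid]
        group
    by_cases hil : i = l
    · subst hil
      cases s
      · rw [← a_def]
        simp only [blockGens_l_false hkl, map_mul, map_inv, homOfGens_a, homOfGens_b,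
            blockGens_k_false, blockGens_k_true, blockGens_l_true hkl, homOfGens_blockGens_mid]
        group
      · rw [← b_def]
        simp only [blockGens_l_true hkl, map_mul, map_inv, homOfGens_a, homOfGens_b,
            blockGens_k_false, blockGens_k_true, homOfGens_blockGens_mid]
        group
    simp only [homOfGens_of, blockGens_of_ne _ _ _ _ hik hil]
  · -- `y ∘ y⁻¹ = id` on the generators
    rintro ⟨i, s⟩
    by_cases hik : i = k
    · subst hik
      cases s
      · rw [← a_def]
        simp only [blockGens_k_false, map_mul, map_inv, homOfGens_a, homOfGens_b,
            blockGens_k_true, blockGens_l_true hkl, homOfGens_blockGens_mid]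
        group
      · rw [← b_def]
        simp only [blockGens_k_true, map_mul, map_inv, homOfGens_a, homOfGens_b,
            blockGens_k_false, blockGens_l_true hkl, homOfGens_blockGens_mid]
        group
    by_cases hil : i = l
    · subst hil
      cases s
      · rw [← a_def]
        simp only [blockGens_l_false hkl, map_mul, map_inv, homOfGens_a, homOfGens_b,
            blockGens_k_false, blockGens_k_true, blockGens_l_true hkl, homOfGens_blockGens_mid]
        group
      · rw [← b_def]
        simp only [blockGens_l_true hkl, map_mul, map_inv, homOfGens_a, homOfGens_b,
            blockGens_k_false, blockGens_k_true, homOfGens_blockGens_mid]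
        group
    simp only [homOfGens_of, blockGens_of_ne _ _ _ _ hik hil]

/-! ## §2 The drag realises the partial conjugation -/

/-- **Registered helper `helper_movesGoeritz_2` — the drag realises the partial conjugation of a trivial
letter by a LATER letter**: for a cut pattern `d` with `d k = true` (handle `k` trivial, handle `l >
k` of either type) the drag of `k` around `l` stabilises `cutKernel d` and induces `x_k ↦ x_l⁻¹ x_k
x_l` through `eraseA`. [folklore] -/
theorem helper_movesGoeritz_2 : ∀ (g : ℕ) (k l : Fin g) (hkl : k < l) (d : Fin g → Bool), d k = true → ∃ y : Literature.Topology.FourManifolds.SurfaceGroup g ≃* Literature.Topology.FourManifolds.SurfaceGroup g, (Literature.Topology.FourManifolds.SurfaceGroup.cutKernel d).map y.toMonoidHom = Literature.Topology.FourManifolds.SurfaceGroup.cutKernel d ∧ ∀ s, Literature.Topology.FourManifolds.SurfaceGroup.eraseA (y s) = partialConj k l (ne_of_lt hkl) (Literature.Topology.FourManifolds.SurfaceGroup.eraseA s) := by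
  intro g k l hkl d hd
  obtain ⟨y, hy, hy'⟩ := exists_dragLt hkl
  have hfix : ∀ i, i ≠ k → i ≠ l → ∀ s, y (PresentedGroup.of (i, s)) = PresentedGroup.of (i, s) :=
    fun i hik hil s => by rw [hy, blockGens_of_ne _ _ _ _ hik hil]
  have hAk : y (a k) =
      a k * b k * (a k)⁻¹ * (b k)⁻¹ * mid k l * (b l)⁻¹ * (mid k l)⁻¹ * a k * mid k l * b l *
      (mid k l)⁻¹ * b k * a k * (b k)⁻¹ * (a k)⁻¹ :=
    (hy (k, false)).trans (blockGens_k_false _ _ _ _)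
  have hBk : y (b k) =
      a k * b k * (a k)⁻¹ * (b k)⁻¹ * mid k l * (b l)⁻¹ * (mid k l)⁻¹ * b k * mid k l * b l *
      (mid k l)⁻¹ * b k * a k * (b k)⁻¹ * (a k)⁻¹ :=
    (hy (k, true)).trans (blockGens_k_true _ _ _ _)
  have hAl : y (a l) =
      (mid k l)⁻¹ * a k * b k * (a k)⁻¹ * (b k)⁻¹ * mid k l * (b l)⁻¹ * (mid k l)⁻¹ * b k * a k *
      (b k)⁻¹ * (a k)⁻¹ * mid k l * b l * a l * (mid k l)⁻¹ * b k * a k * (b k)⁻¹ * (a k)⁻¹ *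
      mid k l :=
    (hy (l, false)).trans (blockGens_l_false hkl _ _ _ _)
  have hBl : y (b l) =
      (mid k l)⁻¹ * a k * b k * (a k)⁻¹ * (b k)⁻¹ * mid k l * b l * (mid k l)⁻¹ * b k * a k *
      (b k)⁻¹ * (a k)⁻¹ * mid k l :=
    (hy (l, true)).trans (blockGens_l_true hkl _ _ _ _)
  have hAk' : y.symm (a k) =
      mid k l * b l * (mid k l)⁻¹ * b k * a k * (b k)⁻¹ * a k * b k * (a k)⁻¹ * (b k)⁻¹ *
      mid k l * (b l)⁻¹ * (mid k l)⁻¹ :=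
    (hy' (k, false)).trans (blockGens_k_false _ _ _ _)
  have hBk' : y.symm (b k) =
      mid k l * b l * (mid k l)⁻¹ * b k * a k * (b k)⁻¹ * (a k)⁻¹ * b k * a k * b k * (a k)⁻¹ *
      (b k)⁻¹ * mid k l * (b l)⁻¹ * (mid k l)⁻¹ :=
    (hy' (k, true)).trans (blockGens_k_true _ _ _ _)
  have hAl' : y.symm (a l) =
      b l * (mid k l)⁻¹ * b k * a k * (b k)⁻¹ * (a k)⁻¹ * mid k l * (b l)⁻¹ * (mid k l)⁻¹ * a k *
      b k * (a k)⁻¹ * (b k)⁻¹ * mid k l * a l * b l * (mid k l)⁻¹ * a k * b k * (a k)⁻¹ *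
      (b k)⁻¹ * mid k l * (b l)⁻¹ :=
    (hy' (l, false)).trans (blockGens_l_false hkl _ _ _ _)
  have hBl' : y.symm (b l) =
      b l * (mid k l)⁻¹ * b k * a k * (b k)⁻¹ * (a k)⁻¹ * mid k l * b l * (mid k l)⁻¹ * a k *
      b k * (a k)⁻¹ * (b k)⁻¹ * mid k l * (b l)⁻¹ :=
    (hy' (l, true)).trans (blockGens_l_true hkl _ _ _ _)
  have hθ : ∀ i, i ≠ k → i ≠ l →
      partialConj k l (ne_of_lt hkl) (FreeGroup.of i) = FreeGroup.of i :=
    fun i hik _ => partialConj_of_ne _ hik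
  refine ⟨y, map_cutKernel_eq_of_block y d k l hfix ?_ ?_ ?_ ?_,
    eraseA_apply_eq_of_block y _ k l hfix hθ ?_ ?_ ?_ ?_⟩
  · -- the cut letter `b` of the knob `k`
    rw [hd, ← b_def, hBk]
    cases hdf : d l
    · simp only [map_mul, map_inv, erase_a_of_eq_true d hd, erase_b_of_eq_true d hd,
        erase_b_of_eq_false d hdf, erase_mid]
      group
    · simp only [map_mul, map_inv, erase_a_of_eq_true d hd, erase_b_of_eq_true d hd,
        erase_b_of_eq_true d hdf, erase_mid]
      group
  · -- the cut letter of the handle `l` (either type)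
    cases hdf : d l
    · rw [← a_def, hAl]
      simp only [map_mul, map_inv, erase_a_of_eq_true d hd, erase_b_of_eq_true d hd,
        erase_a_of_eq_false d hdf, erase_b_of_eq_false d hdf, erase_mid]
      group
    · rw [← b_def, hBl]
      simp only [map_mul, map_inv, erase_a_of_eq_true d hd, erase_b_of_eq_true d hd,
        erase_b_of_eq_true d hdf, erase_mid]
      group
  · -- the cut letter `b` of the knob `k`
    rw [hd, ← b_def, hBk']
    cases hdf : d l
    · simp only [map_mul, map_inv, erase_a_of_eq_true d hd, erase_b_of_eq_true d hd,
        erase_b_of_eq_false d hdf, erase_mid]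
      group
    · simp only [map_mul, map_inv, erase_a_of_eq_true d hd, erase_b_of_eq_true d hd,
        erase_b_of_eq_true d hdf, erase_mid]
      group
  · -- the cut letter of the handle `l` (either type)
    cases hdf : d l
    · rw [← a_def, hAl']
      simp only [map_mul, map_inv, erase_a_of_eq_true d hd, erase_b_of_eq_true d hd,
        erase_a_of_eq_false d hdf, erase_b_of_eq_false d hdf, erase_mid]
      group
    · rw [← b_def, hBl']
      simp only [map_mul, map_inv, erase_a_of_eq_true d hd, erase_b_of_eq_true d hd,
        erase_b_of_eq_true d hdf, erase_mid]
      group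
  · rw [hAk]
    simp only [map_mul, map_inv, eraseA_a, eraseA_b, eraseA_mid]
    group
  · rw [hAl]
    simp only [map_mul, map_inv, eraseA_a, eraseA_b, eraseA_mid]
    group
  · rw [hBk, partialConj_of_self]
    simp only [map_mul, map_inv, eraseA_a, eraseA_b, eraseA_mid]
    group
  · rw [hBl, partialConj_of_ne (ne_of_lt hkl) (ne_of_lt hkl).symm]
    simp only [map_mul, map_inv, eraseA_a, eraseA_b, eraseA_mid]
    group

end Summit.SmoothPoincare4.SmoothPoincare4.Theorems.NormalFormStablyTrivial.Luft

end
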